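import Literature.Probability.LatticeModels.BackboneChainRule
import HarnessLib

/-!
# The chain rule for backbones, two ordered passage points (the zigzag bound `F₁`, `F₄` of Aizenman–Duminil-Copin 2021, Lemma 4.4 / 6.2)

Topic `Literature/Probability/LatticeModels`. Sequel of `BackboneChainRule.lean` (one passage point).
The bound on the events `F₁`, `F₄` in the proof of

* M. Aizenman, H. Duminil-Copin, *Marginal triviality of the scaling limits of critical 4D Ising and
  `φ⁴₄` models*, Ann. of Math. **194** (2021), arXiv:1912.07973 [AizenmanDuminilCopinAnnals2021],
  **Lemma 4.4** (p. 12; the same in Lemma 6.2, p. 21): "For `F₁` to occur, the backbone `Γ(n₁)` must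
  do a zigzag: to go from `0` to a vertex `v ∈ ∂Λ_n`, then to a vertex `w ∈ ∂Λ_{ℓ_k}`, and finally to
  `x`. The chain rule for backbones (see e.g. [AizBarFer87]) … imply that
  `P^{0x,∅}[F₁] ≤ ∑_{v ∈ ∂Λ_n, w ∈ ∂Λ_{ℓ_k}} ⟨σ₀σ_v⟩⟨σ_vσ_w⟩⟨σ_wσ_x⟩/⟨σ₀σ_x⟩`",

is the **two-passage (ordered) chain rule** for the backbone, realised in the tree by the deterministic
exploration `Current.explore rk n Y a` of `CurrentExploration.lean` (Aizenman 1982, §9). This file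
proves it in finite volume, for general couplings `K ≥ 0`, in un-normalised current-sum form:

* `Current.tsum_backboneZigzag_mul_le` — for an injective ranking, a target `Y`, a start `a`, an end
  `b`, a first passage point `u` and a second passage point `w`,
  `(∑ 1{∂n = {a}Δ{b}} w(n) 𝟙[the Y-walk of n from a is at u at some time and at w at some later time]) · Z[∅]²
     ≤ Z[{a}Δ{u}] · Z[{u}Δ{w}] · Z[{w}Δ{b}]`,
  i.e. `P^{ab}[Γ visits u, then w] ≤ ⟨σ_aσ_u⟩⟨σ_uσ_w⟩⟨σ_wσ_b⟩/⟨σ_aσ_b⟩`;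
* `Current.tsum_backboneZigzag_mem_mul_le` — summed over sets `S`, `S'` of passage points (the printed
  double sum over `v ∈ ∂Λ_n`, `w ∈ ∂Λ_{ℓ_k}`).

The new ingredient is the **restart property** of the walk (`Current.RestartInv`,
`Current.pos_exploreAt_add_eq`): after its first visit of `u` (state `s₀`), the walk of `n` with target
`Y` moves exactly as the walk, started afresh at `u`, of the part of `n` off the bonds used by `s₀` —
which, conditionally on the cylinder of `s₀`, is a free current of the model with the interaction
switched off on `used(s₀)` (Aizenman 1982, Lemma 9.2; the tree's `tsum_sources_inCyl_eq`, here with an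
extra functional of the off part, `Current.tsum_sources_inCyl_mul_eq`). The one-passage rule
(`Current.tsum_backboneVisits_mul_le`, `BackboneChainRule.lean`) is then applied twice: to the off part
(couplings `K off used(s₀)`, passage through `w`, Griffiths to return to `K`) and to the cylinder sums
(passage through `u` of the currents with sources `{a} Δ {w}`). No named fact is introduced; everything
is proved.

## References

* M. Aizenman, H. Duminil-Copin, Ann. of Math. 194 (2021), arXiv:1912.07973, §4.2, proof of Lemma 4.4,
  bounds on `F₁`, `F₄` (p. 12); §6.1, proof of Lemma 6.2 (p. 21) [AizenmanDuminilCopinAnnals2021].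
* M. Aizenman, D. J. Barsky, R. Fernández, J. Stat. Phys. 47 (1987) 343–374 (chain rule for backbones)
  — cited by the source.
* M. Aizenman, Comm. Math. Phys. 86 (1982), §9 (Prop. 9.2, Lemma 9.2) [AizenmanCMP1982] — through
  `CurrentExploration*.lean`.
-/

noncomputable section

open Finset
open scoped symmDiff ENNReal

namespace Literature.Probability.LatticeModels

variable {V : Type*} [Fintype V] [DecidableEq V] {G : SimpleGraph V} [DecidableRel G.Adj]

namespace Current

variable {K : G.edgeFinset → ℝ} {rk : G.edgeFinset → ℕ} {Y : Finset V}

/-! ### The restart property of the walk -/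

section Restart

variable {n : Current G}

/-- The correspondence between the walk of `n` continued from a state `s₀` and the walk, started afresh
at `s₀.pos`, of the part of `n` off the bonds used by `s₀`: same site, same halting flag, and the used
bonds differ exactly by `used(s₀)`. [folklore] -/
structure RestartInv (s₀ t t' : XState G) : Prop where
  /-- same current site -/
  pos : t.pos = t'.pos
  /-- same halting flag -/
  done : t.done = t'.done
  /-- used bonds differ by `used(s₀)` -/
  used : t.used = s₀.used ∪ t'.used

/-- The off part `n 𝟙_{used(s₀)ᶜ}` is non-zero exactly on the non-zero bonds of `n` off `used(s₀)`. [folklore] -/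
theorem onEdges_compl_ne_zero_iff {D : Finset G.edgeFinset} {e : G.edgeFinset} :
    onEdges Dᶜ n e ≠ 0 ↔ e ∉ D ∧ n e ≠ 0 := by
  by_cases h : e ∈ D
  · rw [onEdges_apply_of_not_mem n (fun h' => (mem_compl.1 h') h)]; simp [h]
  · rw [onEdges_apply_of_mem n (mem_compl.2 h)]; simp [h]

/-- Under the correspondence the available bonds agree. [folklore] -/
theorem RestartInv.availAt_eq {s₀ t t' : XState G} (h : RestartInv s₀ t t') :
    availAt n t = availAt (onEdges s₀.usedᶜ n) t' := by
  ext e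
  rw [mem_availAt, mem_availAt, h.pos, h.used, onEdges_compl_ne_zero_iff, mem_union, not_or]
  tauto

/-- Under the correspondence the unused bonds at the site differ by `used(s₀)`. [folklore] -/
theorem RestartInv.mem_unusedAt_iff {s₀ t t' : XState G} (h : RestartInv s₀ t t') {e : G.edgeFinset} :
    e ∈ unusedAt t ↔ e ∈ unusedAt t' ∧ e ∉ s₀.used := by
  rw [mem_unusedAt, mem_unusedAt, h.pos, h.used, mem_union, not_or]
  tauto

/-- Finset bookkeeping for the restart: `A ∪ B ∪ U|_p = A ∪ (B ∪ U'|_p)` when `U = U' ∖ A`. [folklore] -/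
theorem union_union_filter_eq {α : Type*} [DecidableEq α] {A B U U' : Finset α} (p : α → Prop)
    [DecidablePred p] (hU : ∀ f, f ∈ U ↔ f ∈ U' ∧ f ∉ A) :
    A ∪ B ∪ U.filter p = A ∪ (B ∪ U'.filter p) := by
  ext f
  simp only [mem_union, mem_filter, hU]
  tauto

/-- Finset bookkeeping for the restart: `A ∪ B ∪ U = A ∪ (B ∪ U')` when `U = U' ∖ A`. [folklore] -/
theorem union_union_eq_of {α : Type*} [DecidableEq α] {A B U U' : Finset α}
    (hU : ∀ f, f ∈ U ↔ f ∈ U' ∧ f ∉ A) : A ∪ B ∪ U = A ∪ (B ∪ U') := by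
  ext f
  simp only [mem_union, hU]
  tauto

/-- **One step preserves the correspondence.** [folklore] -/
theorem RestartInv.xstep (hrk : Function.Injective rk) {s₀ t t' : XState G} (h : RestartInv s₀ t t') :
    RestartInv s₀ (xstep rk n Y t) (xstep rk (onEdges s₀.usedᶜ n) Y t') := by
  have hAeq : availAt n t = availAt (onEdges s₀.usedᶜ n) t' := h.availAt_eq
  rcases xstep_cases (rk := rk) (n := n) (Y := Y) t with ⟨hd, hs⟩ | ⟨hd, hY, hs⟩ | ⟨hd, hY, hA, hs⟩ | ⟨hd, hY, hA, hs⟩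
  · have hd' : t'.done = true := by rw [← h.done]; exact hd
    rw [hs, xstep_of_done hd']; exact h
  · have hd' : t'.done = false := by rw [← h.done]; exact hd
    have hY' : t'.pos ∈ Y := by rw [← h.pos]; exact hY
    rw [hs, xstep_of_mem hd' hY']
    exact ⟨h.pos, rfl, h.used⟩
  · have hd' : t'.done = false := by rw [← h.done]; exact hd
    have hY' : t'.pos ∉ Y := by rw [← h.pos]; exact hY
    have hA' : (availAt (onEdges s₀.usedᶜ n) t').Nonempty := by rw [← hAeq]; exact hA
    rw [hs, xstep_of_nonempty hd' hY' hA']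
    -- the examined bonds agree
    have heA : Function.argminOn rk (↑(availAt n t) : Set G.edgeFinset) hA ∈ availAt n t :=
      argminOn_mem_availAt (rk := rk) hA
    have he'A : Function.argminOn rk (↑(availAt (onEdges s₀.usedᶜ n) t') : Set G.edgeFinset) hA' ∈
        availAt (onEdges s₀.usedᶜ n) t' := argminOn_mem_availAt (rk := rk) hA'
    have hee' : Function.argminOn rk (↑(availAt (onEdges s₀.usedᶜ n) t') : Set G.edgeFinset) hA' =
        Function.argminOn rk (↑(availAt n t) : Set G.edgeFinset) hA := by
      refine hrk (le_antisymm ?_ ?_)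
      · refine rk_argminOn_le (rk := rk) hA' ?_
        rw [← hAeq]; exact heA
      · refine rk_argminOn_le (rk := rk) hA ?_
        rw [hAeq]; exact he'A
    rw [hee']
    set e := Function.argminOn rk (↑(availAt n t) : Set G.edgeFinset) hA with he
    have heu : e ∉ s₀.used := by
      have h1 := (mem_availAt.1 heA).1.2
      rw [h.used, mem_union, not_or] at h1
      exact h1.1
    have hre : onEdges s₀.usedᶜ n e = n e := onEdges_apply_of_mem n (mem_compl.2 heu)
    refine ⟨?_, rfl, ?_⟩
    · show (if Odd (n e) then otherEnd e t.pos else t.pos) =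
        (if Odd (onEdges s₀.usedᶜ n e) then otherEnd e t'.pos else t'.pos)
      rw [hre, h.pos]
    · show t.used ∪ (unusedAt t).filter (fun e'' => rk e'' ≤ rk e) =
        s₀.used ∪ (t'.used ∪ (unusedAt t').filter (fun e'' => rk e'' ≤ rk e))
      rw [h.used]
      exact union_union_filter_eq _ fun f => h.mem_unusedAt_iff
  · have hd' : t'.done = false := by rw [← h.done]; exact hd
    have hY' : t'.pos ∉ Y := by rw [← h.pos]; exact hY
    have hA' : ¬ (availAt (onEdges s₀.usedᶜ n) t').Nonempty := by
      rw [← hAeq, hA]; exact Finset.not_nonempty_empty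
    rw [hs, xstep_of_empty hd' hY' hA']
    refine ⟨h.pos, rfl, ?_⟩
    show t.used ∪ unusedAt t = s₀.used ∪ (t'.used ∪ unusedAt t')
    rw [h.used]
    exact union_union_eq_of fun f => h.mem_unusedAt_iff

/-- **The restart property** (iterated): the walk of `n` continued for `j` steps from a non-halted state
`s₀` corresponds to the `j`-th state of the walk of the off part started at `s₀.pos`. [folklore] -/
theorem restartInv_iterate (hrk : Function.Injective rk) {s₀ : XState G} (hd : s₀.done = false) (j : ℕ) :
    RestartInv s₀ ((Current.xstep rk n Y)^[j] s₀) (exploreAt rk (onEdges s₀.usedᶜ n) Y s₀.pos j) := by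
  induction j with
  | zero =>
    rw [Function.iterate_zero_apply, exploreAt_zero]
    refine ⟨rfl, ?_, ?_⟩
    · show s₀.done = false
      exact hd
    · show s₀.used = s₀.used ∪ ∅
      rw [Finset.union_empty]
  | succ j ih =>
    rw [Function.iterate_succ_apply', exploreAt_succ]
    exact ih.xstep hrk

/-- **The restart property for the walk from `a`**: if the state at time `T` is not halted, the positions
from time `T` on are those of the walk of the off part started at the site reached at time `T`. [folklore] -/
theorem pos_exploreAt_add_eq (hrk : Function.Injective rk) (a : V) {T : ℕ}
    (hd : (exploreAt rk n Y a T).done = false) (j : ℕ) :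
    (exploreAt rk n Y a (T + j)).pos =
      (exploreAt rk (onEdges (exploreAt rk n Y a T).usedᶜ n) Y (exploreAt rk n Y a T).pos j).pos := by
  have h := (restartInv_iterate (n := n) (Y := Y) hrk hd j).pos
  rw [← h]
  unfold exploreAt
  rw [add_comm, Function.iterate_add_apply]

end Restart

/-! ### First visit of `u`: the state `s₀` and the walk with target `Y ∪ {u}` -/

section FirstVisit

variable {n : Current G}

/-- A step that moves the walk is an examination, after which the walk is not halted. [folklore] -/
theorem done_xstep_eq_false_of_pos_ne {s : XState G} (h : (xstep rk n Y s).pos ≠ s.pos) :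
    (xstep rk n Y s).done = false := by
  rcases xstep_cases (rk := rk) (n := n) (Y := Y) s with ⟨-, hs⟩ | ⟨-, -, hs⟩ | ⟨-, -, hA, hs⟩ | ⟨-, -, -, hs⟩
  · rw [hs] at h; exact absurd rfl h
  · rw [hs] at h; exact absurd rfl h
  · rw [hs]; rfl
  · rw [hs] at h; exact absurd rfl h

/-- Past the horizon the walk is at its final site. [folklore] -/
theorem pos_exploreAt_of_le (a : V) {k : ℕ} (hk : Fintype.card G.edgeFinset + 1 ≤ k) :
    (exploreAt rk n Y a k).pos = (explore rk n Y a).pos := by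
  rw [exploreAt_eq_explore_of_le a hk]

/-- **The first visit of `u`**: if the walk from `a` with target `Y` is at `u` at time `k`, then at the
first such time `T` it is not halted, it avoided `Y ∪ {u}` before, `T` is within the horizon, and the
walk with target `Y ∪ {u}` has the same state at `T` and ends at `u` with the same used bonds and pattern.
[folklore] -/
theorem firstVisit (a : V) {u : V} {k : ℕ} (hk : (exploreAt rk n Y a k).pos = u) :
    ∃ T, T ≤ k ∧ T ≤ Fintype.card G.edgeFinset + 1 ∧ (exploreAt rk n Y a T).pos = u ∧
      (exploreAt rk n Y a T).done = false ∧
      exploreAt rk n (Y ∪ {u}) a T = exploreAt rk n Y a T ∧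
      (explore rk n (Y ∪ {u}) a).pos = u ∧
      (explore rk n (Y ∪ {u}) a).used = (exploreAt rk n Y a T).used ∧
      (explore rk n (Y ∪ {u}) a).pat = (exploreAt rk n Y a T).pat := by
  classical
  have hex : ∃ T, (exploreAt rk n Y a T).pos = u := ⟨k, hk⟩
  set T := Nat.find hex with hT
  have hTspec : (exploreAt rk n Y a T).pos = u := Nat.find_spec hex
  have hTmin : ∀ j, j < T → (exploreAt rk n Y a j).pos ≠ u := fun j hj => Nat.find_min hex hj
  have hTk : T ≤ k := Nat.find_min' hex hk
  -- before `T` the walk avoids `Y` too (else it would freeze away from `u`)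
  have hnotY : ∀ j, j < T → (exploreAt rk n Y a j).pos ∉ Y := by
    intro j hj hjY
    have := pos_exploreAt_eq_of_mem_target (rk := rk) (n := n) (Y := Y) a hjY hj.le
    exact hTmin j hj (this ▸ hTspec)
  -- `T` is within the horizon
  set N := Fintype.card G.edgeFinset + 1 with hN
  have hTN : T ≤ N := by
    by_contra hlt
    have hNT : N < T := not_le.1 hlt
    have h1 : (exploreAt rk n Y a T).pos = (exploreAt rk n Y a N).pos := by
      rw [pos_exploreAt_of_le a (le_of_lt hNT), explore_eq_exploreAt]
    exact hTmin N hNT (h1 ▸ hTspec)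
  -- not halted at `T`
  have hdone : (exploreAt rk n Y a T).done = false := by
    rcases Nat.eq_zero_or_pos T with h0 | hpos
    · rw [h0, exploreAt_zero]; rfl
    · have hT' : T = (T - 1) + 1 := by omega
      rw [hT', exploreAt_succ]
      refine done_xstep_eq_false_of_pos_ne ?_
      rw [← exploreAt_succ, ← hT', hTspec]
      exact Ne.symm (hTmin (T - 1) (by omega))
  -- the walk with target `Y ∪ {u}` agrees up to `T`
  have hagree : exploreAt rk n (Y ∪ {u}) a T = exploreAt rk n Y a T := by
    refine exploreAt_target_congr_of_lt a fun j hj => ?_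
    rw [mem_union, mem_singleton]
    exact ⟨fun h => Or.inl h, fun h => h.elim id fun h' => absurd h' (hTmin j hj)⟩
  -- and then freezes at `u`: same site, used bonds and pattern at all later times
  have htarget : (exploreAt rk n (Y ∪ {u}) a T).pos ∈ Y ∪ {u} := by
    rw [hagree, hTspec]; exact mem_union_right _ (mem_singleton_self u)
  have hfreeze : ∀ j, T ≤ j → (exploreAt rk n (Y ∪ {u}) a j).pos = u ∧
      (exploreAt rk n (Y ∪ {u}) a j).used = (exploreAt rk n Y a T).used ∧
      (exploreAt rk n (Y ∪ {u}) a j).pat = (exploreAt rk n Y a T).pat := by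
    intro j hj
    induction hj with
    | refl => exact ⟨by rw [hagree, hTspec], by rw [hagree], by rw [hagree]⟩
    | step hle ih =>
      obtain ⟨ih1, ih2, ih3⟩ := ih
      rw [exploreAt_succ]
      set s := exploreAt rk n (Y ∪ {u}) a _ with hs
      have hsY : s.pos ∈ Y ∪ {u} := by rw [ih1]; exact mem_union_right _ (mem_singleton_self u)
      rcases xstep_cases (rk := rk) (n := n) (Y := Y ∪ {u}) s with ⟨-, h⟩ | ⟨-, -, h⟩ | ⟨-, hY', -, -⟩ | ⟨-, hY', -, -⟩
      · rw [h]; exact ⟨ih1, ih2, ih3⟩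
      · rw [h]; exact ⟨ih1, ih2, ih3⟩
      · exact absurd hsY hY'
      · exact absurd hsY hY'
  obtain ⟨hf1, hf2, hf3⟩ := hfreeze N hTN
  refine ⟨T, hTk, hTN, hTspec, hdone, hagree, ?_, ?_, ?_⟩
  · rw [explore_eq_exploreAt]; exact hf1
  · rw [explore_eq_exploreAt]; exact hf2
  · rw [explore_eq_exploreAt]; exact hf3

/-- **The zigzag event read on the cylinder of the first visit.** If the walk of `n` from `a` with target
`Y` is at `u` at some time and at `w` at some later time, then the walk with target `Y ∪ {u}` ends at
`u`, and the walk of the off part `n 𝟙_{used(δ)ᶜ}` (`δ` its final state) from `u` with target `Y`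
visits `w`. [cite: AizenmanDuminilCopinAnnals2021, arXiv:1912.07973 §4.2, proof of Lemma 4.4 (the zigzag of Γ(n₁), event F₁) (p. 12)] -/
theorem zigzag_imp (hrk : Function.Injective rk) (a : V) {u w : V} {k₀ k₁ : ℕ} (hk : k₀ ≤ k₁)
    (h₀ : (exploreAt rk n Y a k₀).pos = u) (h₁ : (exploreAt rk n Y a k₁).pos = w) :
    (explore rk n (Y ∪ {u}) a).pos = u ∧
      w ∈ (explore rk (onEdges (explore rk n (Y ∪ {u}) a).usedᶜ n) Y u).vis := by
  obtain ⟨T, hTk, -, hTpos, hTdone, -, hpos', hused', -⟩ := firstVisit (rk := rk) (n := n) a h₀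
  refine ⟨hpos', ?_⟩
  rw [hused']
  -- positions after `T` are those of the walk of the off part
  have hrestart := pos_exploreAt_add_eq (n := n) (Y := Y) hrk a hTdone (k₁ - T)
  rw [show T + (k₁ - T) = k₁ by omega, h₁, hTpos] at hrestart
  -- `w` is a position of that walk, hence visited
  set r := onEdges (exploreAt rk n Y a T).usedᶜ n with hr
  set N := Fintype.card G.edgeFinset + 1 with hN
  have hvis : w ∈ (exploreAt rk r Y u (k₁ - T)).vis := by
    rw [hrestart]; exact (pos_mem_vis_exploreAt (rk := rk) (n := r) (Y := Y) u (k₁ - T)).1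
  by_cases hle : k₁ - T ≤ N
  · rw [explore_eq_exploreAt]
    exact vis_exploreAt_mono hle hvis
  · rw [← exploreAt_eq_explore_of_le u (le_of_not_ge hle)]
    exact hvis

end FirstVisit

/-! ### The cylinder sums with a functional of the off part -/

section Cylinder

variable {n₀ : Current G}

/-- **Weight factorisation of the cylinder with a functional of the off part** (Aizenman 1982, Prop. 9.2
/ Lemma 9.2, as in the tree's `tsum_sources_inCyl_eq`, with an extra factor `Ψ` of the part of the
current off the used bonds): for the walk `δ` of `n₀` from `a`,
`∑_{∂n = A, n ∈ Cyl(δ)} w_K(n) Ψ(n 𝟙_{used(δ)ᶜ}) = patSum K δ · ∑_{r ≡ 0 on used(δ), ∂r = A Δ {a} Δ {b}} w_K(r) Ψ(r)`,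
`b` the final site. [cite: AizenmanCMP1982, Prop. 9.2, eq. (9.8) and Lemma 9.2] -/
theorem tsum_sources_inCyl_mul_eq (hK : ∀ e, 0 ≤ K e) (hrk : Function.Injective rk) {Y' : Finset V} {a : V}
    {δ : XState G} (hδ : δ = explore rk n₀ Y' a) (A : Finset V) (Ψ : Current G → ℝ≥0∞) :
    ∑' n : Current G, (if n.sources = A ∧ InCyl δ n then n.eweight K else 0) * Ψ (onEdges δ.usedᶜ n) =
      patSum K δ * ∑' r : Current G,
        (if (∀ e, e ∈ δ.used → r e = 0) ∧ r.sources = A ∆ ({a} ∆ {δ.pos}) then r.eweight K else 0) * Ψ r := by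
  have hsrc : ∀ m : Current G, (∀ e, e ∉ δ.used → m e = 0) → InCyl δ m → m.sources = {a} ∆ {δ.pos} := by
    intro m h0 hc
    subst hδ
    refine sources_eq_of_cls_eq hrk a h0 fun e he => ?_
    rw [hc e he, pat_explore a he]
  rw [tsum_eq_tsum_prod_onEdges δ.used, patSum, tsum_mul_tsum_eq_tsum_prod]
  refine tsum_congr fun p => ?_
  by_cases hm : (∀ e, e ∉ δ.used → p.1 e = 0)
  · by_cases hr : (∀ e, e ∈ δ.used → p.2 e = 0)
    · rw [if_pos ⟨hm, hr⟩, onEdges_compl_add_eq_right hm hr]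
      have hw : (p.1 + p.2).eweight K = p.1.eweight K * p.2.eweight K :=
        eweight_add_of_forall_or hK fun e => by
          by_cases he : e ∈ δ.used
          · exact Or.inr (hr e he)
          · exact Or.inl (hm e he)
      by_cases hc : InCyl δ p.1
      · have hc' : InCyl δ (p.1 + p.2) := (inCyl_add_iff_of_forall hr).mpr hc
        have hs1 : (p.1 + p.2).sources = ({a} ∆ {δ.pos}) ∆ p.2.sources := by
          rw [Current.sources_add, hsrc p.1 hm hc]
        by_cases hs : p.2.sources = A ∆ ({a} ∆ {δ.pos})
        · have hsA : (p.1 + p.2).sources = A := by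
            rw [hs1, hs, symmDiff_comm A, symmDiff_symmDiff_cancel_left]
          rw [if_pos ⟨hsA, hc'⟩, if_pos ⟨hm, hc⟩, if_pos ⟨hr, hs⟩, hw]
          ring
        · have hsA : (p.1 + p.2).sources ≠ A := fun h => hs (by
            rw [hs1, symmDiff_eq_iff_eq, symmDiff_comm] at h; exact h)
          rw [if_neg (fun h => hsA h.1), if_pos ⟨hm, hc⟩,
            if_neg (show ¬ ((∀ e, e ∈ δ.used → p.2 e = 0) ∧ p.2.sources = A ∆ ({a} ∆ {δ.pos})) from
              fun h => hs h.2)]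
          simp
      · have hc' : ¬ InCyl δ (p.1 + p.2) := fun h => hc ((inCyl_add_iff_of_forall hr).mp h)
        rw [if_neg (fun h => hc' h.2), if_neg (fun h => hc h.2)]
        simp
    · rw [if_neg (fun h => hr h.2),
        if_neg (show ¬ ((∀ e, e ∈ δ.used → p.2 e = 0) ∧ p.2.sources = A ∆ ({a} ∆ {δ.pos})) from
          fun h => hr h.1)]
      simp
  · rw [if_neg (fun h => hm h.1), if_neg (fun h => hm h.1)]
    simp

/-- The off-part sum is the current sum of the switched-off couplings with the functional:
`∑_{r ≡ 0 on D, ∂r = B} w_K(r) Ψ(r) = ∑_r 1{∂r = B} w_{K off D}(r) Ψ(r)`. [folklore] -/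
theorem tsum_off_eq_tsum_koff (D : Finset G.edgeFinset) (B : Finset V) (Ψ : Current G → ℝ≥0∞) :
    ∑' r : Current G, (if (∀ e, e ∈ D → r e = 0) ∧ r.sources = B then r.eweight K else 0) * Ψ r =
      ∑' r : Current G, (if r.sources = B then r.eweight (koff K D) else 0) * Ψ r := by
  refine tsum_congr fun r => ?_
  rw [eweight_koff]
  by_cases h2 : r.sources = B
  · by_cases h1 : ∀ e, e ∈ D → r e = 0
    · rw [if_pos ⟨h1, h2⟩, if_pos h2, if_pos h1]
    · rw [if_neg (fun h => h1 h.1), if_pos h2, if_neg h1]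
  · rw [if_neg (fun h => h2 h.2), if_neg h2]

end Cylinder

/-! ### The two-passage chain rule -/

/-- The zigzag event: the walk is at `u` at some time and at `w` at some later time. [cite: AizenmanDuminilCopinAnnals2021, arXiv:1912.07973 §4.2, proof of Lemma 4.4 (event F₁: "Γ(n₁) does two successive crossings") (p. 12)] -/
def Zigzag (rk : G.edgeFinset → ℕ) (n : Current G) (Y : Finset V) (a u w : V) : Prop :=
  ∃ k₀ k₁ : ℕ, k₀ ≤ k₁ ∧ (exploreAt rk n Y a k₀).pos = u ∧ (exploreAt rk n Y a k₁).pos = w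

/-- **The zigzag indicator is dominated by the cylinder decomposition at the first visit of `u`**:
`𝟙[zigzag through u then w] ≤ ∑_{δ ends at u} 𝟙[n ∈ Cyl(δ)] 𝟙[w visited by the Y-walk of n𝟙_{used(δ)ᶜ} from u]`,
`δ` over the final states of walks with target `Y ∪ {u}`. [folklore] -/
theorem indicator_zigzag_le_sum (hrk : Function.Injective rk) (n : Current G) (a u w : V)
    [Decidable (Zigzag rk n Y a u w)] :
    (if Zigzag rk n Y a u w then (1 : ℝ≥0∞) else 0) ≤
      ∑ δ ∈ finalStates rk (Y ∪ {u}) a u, (if InCyl δ n then (1 : ℝ≥0∞) else 0) *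
        (if w ∈ (explore rk (onEdges δ.usedᶜ n) Y u).vis then 1 else 0) := by
  classical
  split_ifs with hz
  · obtain ⟨k₀, k₁, hk, h₀, h₁⟩ := hz
    obtain ⟨hpos, hvis⟩ := zigzag_imp (n := n) (Y := Y) hrk a hk h₀ h₁
    have hmem : explore rk n (Y ∪ {u}) a ∈ finalStates rk (Y ∪ {u}) a u :=
      mem_finalStates_iff.2 ⟨hpos, n, rfl⟩
    calc (1 : ℝ≥0∞) = (if InCyl (explore rk n (Y ∪ {u}) a) n then (1 : ℝ≥0∞) else 0) *
          (if w ∈ (explore rk (onEdges (explore rk n (Y ∪ {u}) a).usedᶜ n) Y u).vis then 1 else 0) := by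
          rw [if_pos (inCyl_explore n a), if_pos hvis, mul_one]
      _ ≤ _ := Finset.single_le_sum (f := fun δ => (if InCyl δ n then (1 : ℝ≥0∞) else 0) *
            (if w ∈ (explore rk (onEdges δ.usedᶜ n) Y u).vis then 1 else 0)) (fun _ _ => bot_le) hmem
  · exact bot_le

/-- **The chain rule for backbones, two ordered passage points** (Aizenman–Barsky–Fernández 1987, as used
by Aizenman–Duminil-Copin 2021 for the zigzag events `F₁`, `F₄` of Lemma 4.4 / 6.2), finite volume,
current-sum form: for `K ≥ 0`, an injective ranking, a target `Y`, vertices `a, b`, a first passage point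
`u` and a second one `w`,
`(∑ 1{∂n = {a}Δ{b}} w(n) 𝟙[the Y-walk of n from a is at u and later at w]) · Z[∅]² ≤ Z[{a}Δ{u}] · Z[{u}Δ{w}] · Z[{w}Δ{b}]`,
i.e. `P^{ab}[Γ visits u, then w] ≤ ⟨σ_aσ_u⟩⟨σ_uσ_w⟩⟨σ_wσ_b⟩/⟨σ_aσ_b⟩`.
[cite: AizenmanDuminilCopinAnnals2021, arXiv:1912.07973 §4.2, proof of Lemma 4.4, bound on F₁ ("The chain rule for backbones") (p. 12)] -/
theorem tsum_backboneZigzag_mul_le (hK : ∀ e, 0 ≤ K e) (hrk : Function.Injective rk) (Y : Finset V)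
    (a b u w : V) [DecidablePred fun n : Current G => Zigzag rk n Y a u w] :
    (∑' n : Current G, (if n.sources = {a} ∆ {b} then n.eweight K else 0) *
        (if Zigzag rk n Y a u w then 1 else 0)) * ecurrentSum K ∅ ^ 2 ≤
      ecurrentSum K ({a} ∆ {u}) * ecurrentSum K ({u} ∆ {w}) * ecurrentSum K ({w} ∆ {b}) := by
  classical
  set Y' : Finset V := Y ∪ {u} with hY'
  set FS := finalStates rk Y' a u with hFS
  -- Step 1: the cylinder decomposition of the zigzag mass
  have hdec : (∑' n : Current G, (if n.sources = {a} ∆ {b} then n.eweight K else 0) *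
      (if Zigzag rk n Y a u w then 1 else 0)) ≤
      ∑ δ ∈ FS, patSum K δ * ∑' r : Current G,
        (if r.sources = {u} ∆ {b} then r.eweight (koff K δ.used) else 0) *
          (if w ∈ (explore rk r Y u).vis then 1 else 0) := by
    calc (∑' n : Current G, (if n.sources = {a} ∆ {b} then n.eweight K else 0) *
          (if Zigzag rk n Y a u w then 1 else 0))
        ≤ ∑' n : Current G, (if n.sources = {a} ∆ {b} then n.eweight K else 0) *
            ∑ δ ∈ FS, (if InCyl δ n then (1 : ℝ≥0∞) else 0) *
              (if w ∈ (explore rk (onEdges δ.usedᶜ n) Y u).vis then 1 else 0) :=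
          ENNReal.tsum_le_tsum fun n => mul_le_mul' le_rfl (indicator_zigzag_le_sum hrk n a u w)
      _ = ∑ δ ∈ FS, ∑' n : Current G, (if n.sources = {a} ∆ {b} ∧ InCyl δ n then n.eweight K else 0) *
            (if w ∈ (explore rk (onEdges δ.usedᶜ n) Y u).vis then 1 else 0) := by
          simp_rw [Finset.mul_sum]
          rw [Summable.tsum_finsetSum (fun _ _ => ENNReal.summable)]
          refine Finset.sum_congr rfl fun δ _ => tsum_congr fun n => ?_
          by_cases h1 : n.sources = {a} ∆ {b} <;> by_cases h2 : InCyl δ n <;> simp [h1, h2]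
      _ = ∑ δ ∈ FS, patSum K δ * ∑' r : Current G,
            (if r.sources = {u} ∆ {b} then r.eweight (koff K δ.used) else 0) *
              (if w ∈ (explore rk r Y u).vis then 1 else 0) := by
          refine Finset.sum_congr rfl fun δ hδ => ?_
          obtain ⟨hpos, n₀, hδ'⟩ := mem_finalStates_iff.1 hδ
          rw [tsum_sources_inCyl_mul_eq hK hrk hδ' ({a} ∆ {b})
            (fun r => if w ∈ (explore rk r Y u).vis then 1 else 0), hpos,
            symmDiff_symmDiff_symmDiff_left, symmDiff_comm ({b} : Finset V) {u}, tsum_off_eq_tsum_koff]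
  -- Step 2: the one-passage rule for the off part, couplings `K off used(δ)`, then Griffiths
  have hoff : ∀ δ ∈ FS, (∑' r : Current G,
      (if r.sources = {u} ∆ {b} then r.eweight (koff K δ.used) else 0) *
        (if w ∈ (explore rk r Y u).vis then 1 else 0)) * ecurrentSum K ∅ ≤
      ecurrentSum (koff K δ.used) ({u} ∆ {w}) * ecurrentSum K ({w} ∆ {b}) := by
    intro δ _
    set K' := koff K δ.used with hK'
    have hK'0 : ∀ e, 0 ≤ K' e := koff_nonneg hK δ.used
    have h0 : ecurrentSum K' (∅ : Finset V) ≠ 0 := ecurrentSum_empty_ne_zero K'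
    have htop : ecurrentSum K' (∅ : Finset V) ≠ ∞ := ecurrentSum_ne_top hK'0 ∅
    -- one-passage rule with `S = {w}` for the couplings `K'`
    have h1 := tsum_backboneVisits_mul_le (rk := rk) hK'0 hrk Y u b {w}
    rw [Finset.sum_singleton] at h1
    have h1' : (∑' r : Current G, (if r.sources = {u} ∆ {b} then r.eweight K' else 0) *
        (if w ∈ (explore rk r Y u).vis then 1 else 0)) * ecurrentSum K' ∅ ≤
        ecurrentSum K' ({u} ∆ {w}) * ecurrentSum K' ({w} ∆ {b}) := by
      refine le_trans (mul_le_mul' (ENNReal.tsum_le_tsum fun r => mul_le_mul' le_rfl ?_) le_rfl) h1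
      by_cases hw : w ∈ (explore rk r Y u).vis
      · rw [if_pos hw, if_pos ⟨w, mem_inter.2 ⟨hw, mem_singleton_self w⟩⟩]
      · rw [if_neg hw]; exact bot_le
    -- Griffiths: `Z'[wb] Z[∅] ≤ Z[wb] Z'[∅]`, and cancel `Z'[∅]`
    have h2 := ecurrentSum_koff_mul_le hK δ.used ({w} ∆ {b})
    have h3 : (∑' r : Current G, (if r.sources = {u} ∆ {b} then r.eweight K' else 0) *
        (if w ∈ (explore rk r Y u).vis then 1 else 0)) * ecurrentSum K ∅ * ecurrentSum K' ∅ ≤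
        ecurrentSum K' ({u} ∆ {w}) * ecurrentSum K ({w} ∆ {b}) * ecurrentSum K' ∅ :=
      calc _ = (∑' r : Current G, (if r.sources = {u} ∆ {b} then r.eweight K' else 0) *
            (if w ∈ (explore rk r Y u).vis then 1 else 0)) * ecurrentSum K' ∅ * ecurrentSum K ∅ := by ring
        _ ≤ ecurrentSum K' ({u} ∆ {w}) * ecurrentSum K' ({w} ∆ {b}) * ecurrentSum K ∅ :=
            mul_le_mul' h1' le_rfl
        _ = ecurrentSum K' ({u} ∆ {w}) * (ecurrentSum K' ({w} ∆ {b}) * ecurrentSum K ∅) := by ring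
        _ ≤ ecurrentSum K' ({u} ∆ {w}) * (ecurrentSum K ({w} ∆ {b}) * ecurrentSum K' ∅) :=
            mul_le_mul' le_rfl h2
        _ = _ := by ring
    exact (ENNReal.mul_le_mul_iff_left h0 htop).1 h3
  -- Step 3: the cylinder sums `∑_δ patSum(δ) Z_off[uw]` are a passage mass for the sources `{a} Δ {w}`
  have hcyl : (∑ δ ∈ FS, patSum K δ * ecurrentSum (koff K δ.used) ({u} ∆ {w})) * ecurrentSum K ∅ ≤
      ecurrentSum K ({a} ∆ {u}) * ecurrentSum K ({u} ∆ {w}) := by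
    have hid : ∑ δ ∈ FS, patSum K δ * ecurrentSum (koff K δ.used) ({u} ∆ {w}) =
        ∑' n : Current G, (if n.sources = {a} ∆ {w} then n.eweight K else 0) *
          (if (explore rk n Y' a).pos = u then 1 else 0) := by
      rw [tsum_mul_indicator_pos_eq_sum hrk]
      refine Finset.sum_congr rfl fun δ hδ => ?_
      rw [tsum_inCyl_of_mem_finalStates hK hrk hδ, symmDiff_symmDiff_symmDiff_left, symmDiff_comm]
    rw [hid]
    exact tsum_backbonePass_mul_le hK hrk Y' a w u
  -- Assembly
  calc (∑' n : Current G, (if n.sources = {a} ∆ {b} then n.eweight K else 0) *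
        (if Zigzag rk n Y a u w then 1 else 0)) * ecurrentSum K ∅ ^ 2
      ≤ (∑ δ ∈ FS, patSum K δ * ∑' r : Current G,
          (if r.sources = {u} ∆ {b} then r.eweight (koff K δ.used) else 0) *
            (if w ∈ (explore rk r Y u).vis then 1 else 0)) * ecurrentSum K ∅ ^ 2 :=
        mul_le_mul' hdec le_rfl
    _ = (∑ δ ∈ FS, patSum K δ * ((∑' r : Current G,
          (if r.sources = {u} ∆ {b} then r.eweight (koff K δ.used) else 0) *
            (if w ∈ (explore rk r Y u).vis then 1 else 0)) * ecurrentSum K ∅)) * ecurrentSum K ∅ := by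
        rw [sq, ← mul_assoc, Finset.sum_mul]
        congr 1
        refine Finset.sum_congr rfl fun δ _ => ?_
        ring
    _ ≤ (∑ δ ∈ FS, patSum K δ * (ecurrentSum (koff K δ.used) ({u} ∆ {w}) * ecurrentSum K ({w} ∆ {b}))) *
          ecurrentSum K ∅ :=
        mul_le_mul' (Finset.sum_le_sum fun δ hδ => mul_le_mul' le_rfl (hoff δ hδ)) le_rfl
    _ = (∑ δ ∈ FS, patSum K δ * ecurrentSum (koff K δ.used) ({u} ∆ {w})) * ecurrentSum K ∅ *
          ecurrentSum K ({w} ∆ {b}) := by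
        rw [Finset.sum_mul, Finset.sum_mul, Finset.sum_mul]
        refine Finset.sum_congr rfl fun δ _ => ?_
        ring
    _ ≤ ecurrentSum K ({a} ∆ {u}) * ecurrentSum K ({u} ∆ {w}) * ecurrentSum K ({w} ∆ {b}) :=
        mul_le_mul' hcyl le_rfl

/-- The zigzag through the sets `S`, then `S'`: some `u ∈ S` is visited and some `w ∈ S'` later.
[cite: AizenmanDuminilCopinAnnals2021, arXiv:1912.07973 §4.2, proof of Lemma 4.4 (event F₁) (p. 12)] -/
def ZigzagSets (rk : G.edgeFinset → ℕ) (n : Current G) (Y : Finset V) (a : V) (S S' : Finset V) : Prop :=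
  ∃ u ∈ S, ∃ w ∈ S', Zigzag rk n Y a u w

/-- **The chain rule for backbones, zigzag through two sets** (the printed form of the bound on `F₁`:
"`P^{0x,∅}[F₁] ≤ ∑_{v ∈ ∂Λ_n, w ∈ ∂Λ_{ℓ_k}} ⟨σ₀σ_v⟩⟨σ_vσ_w⟩⟨σ_wσ_x⟩/⟨σ₀σ_x⟩`"): for any sets `S`, `S'`
of passage points,
`(∑ 1{∂n = {a}Δ{b}} w(n) 𝟙[the Y-walk zigzags through S then S']) · Z[∅]² ≤ ∑_{u ∈ S} ∑_{w ∈ S'} Z[{a}Δ{u}] Z[{u}Δ{w}] Z[{w}Δ{b}]`.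
[cite: AizenmanDuminilCopinAnnals2021, arXiv:1912.07973 §4.2, proof of Lemma 4.4, display (4.8) bound on F₁ (p. 12)] -/
theorem tsum_backboneZigzag_mem_mul_le (hK : ∀ e, 0 ≤ K e) (hrk : Function.Injective rk) (Y : Finset V)
    (a b : V) (S S' : Finset V) [DecidablePred fun n : Current G => ZigzagSets rk n Y a S S'] :
    (∑' n : Current G, (if n.sources = {a} ∆ {b} then n.eweight K else 0) *
        (if ZigzagSets rk n Y a S S' then 1 else 0)) * ecurrentSum K ∅ ^ 2 ≤
      ∑ u ∈ S, ∑ w ∈ S', ecurrentSum K ({a} ∆ {u}) * ecurrentSum K ({u} ∆ {w}) * ecurrentSum K ({w} ∆ {b}) := by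
  classical
  have hind : ∀ n : Current G, (if ZigzagSets rk n Y a S S' then (1 : ℝ≥0∞) else 0) ≤
      ∑ u ∈ S, ∑ w ∈ S', (if Zigzag rk n Y a u w then 1 else 0) := by
    intro n
    split_ifs with h
    · obtain ⟨u, hu, w, hw, hz⟩ := h
      calc (1 : ℝ≥0∞) = if Zigzag rk n Y a u w then 1 else 0 := by rw [if_pos hz]
        _ ≤ ∑ w' ∈ S', (if Zigzag rk n Y a u w' then (1 : ℝ≥0∞) else 0) :=
            Finset.single_le_sum (f := fun w' => if Zigzag rk n Y a u w' then (1 : ℝ≥0∞) else 0)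
              (fun _ _ => bot_le) hw
        _ ≤ ∑ u' ∈ S, ∑ w' ∈ S', (if Zigzag rk n Y a u' w' then (1 : ℝ≥0∞) else 0) :=
            Finset.single_le_sum (f := fun u' => ∑ w' ∈ S', (if Zigzag rk n Y a u' w' then (1 : ℝ≥0∞) else 0))
              (fun _ _ => bot_le) hu
    · exact bot_le
  calc (∑' n : Current G, (if n.sources = {a} ∆ {b} then n.eweight K else 0) *
        (if ZigzagSets rk n Y a S S' then 1 else 0)) * ecurrentSum K ∅ ^ 2
      ≤ (∑' n : Current G, (if n.sources = {a} ∆ {b} then n.eweight K else 0) *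
          ∑ u ∈ S, ∑ w ∈ S', (if Zigzag rk n Y a u w then (1 : ℝ≥0∞) else 0)) * ecurrentSum K ∅ ^ 2 :=
        mul_le_mul' (ENNReal.tsum_le_tsum fun n => mul_le_mul' le_rfl (hind n)) le_rfl
    _ = ∑ u ∈ S, ∑ w ∈ S', (∑' n : Current G, (if n.sources = {a} ∆ {b} then n.eweight K else 0) *
          (if Zigzag rk n Y a u w then (1 : ℝ≥0∞) else 0)) * ecurrentSum K ∅ ^ 2 := by
        simp_rw [Finset.mul_sum]
        rw [Summable.tsum_finsetSum (fun _ _ => ENNReal.summable), Finset.sum_mul]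
        refine Finset.sum_congr rfl fun u _ => ?_
        rw [Summable.tsum_finsetSum (fun _ _ => ENNReal.summable), Finset.sum_mul]
    _ ≤ ∑ u ∈ S, ∑ w ∈ S', ecurrentSum K ({a} ∆ {u}) * ecurrentSum K ({u} ∆ {w}) * ecurrentSum K ({w} ∆ {b}) :=
        Finset.sum_le_sum fun u _ => Finset.sum_le_sum fun w _ => tsum_backboneZigzag_mul_le hK hrk Y a b u w

end Current

end Literature.Probability.LatticeModels
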